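import Literature.IUT.HodgeArakelov.GMonoidFrobenioidsComposition
import Literature.AnabelianGeometry.SemiGraphs.CosetCategoriesPullComp
import HarnessLib

/-!
# [IUTchII] Corollary 3.7 (i) «compatible collections of isomorphisms» at the Frobenioid level, form (b): the functors of
# model Frobenioids over a CHANGE OF BASE compose — `F(σ₁,ψ₁) ⋙ F(σ₂,ψ₂) = F(σ₂σ₁, ψ₂ψ₁)` — and squares over
# re-factorized group identifications commute ON THE NOSE

S. Mochizuki, *Inter-universal Teichmüller theory II*, §3, kurims manuscript (Dec. 2020): Corollary 3.7 (i) p. 111 l. 21 –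
p. 112 l. 6 «Each isomorphism of projective systems of mono-theta environments `M^Θ_*(Π_v) ⥲ M^Θ_*(†F_v)` induces compatible
[in the evident sense] collections of isomorphisms … `{G_v(M^Θ_*▶(†F_v))_{|t|}} ⥲ {G_v(M^Θ_*(†F_v))_{|t|}}` ↷↷ `Ψ_ξ(M^Θ_*(Π_v)) ⥲
Ψ_ξ(M^Θ_*(†F_v)) ⥲ Ψ_{F_ξ}(†F_v)`»; Definition 3.8 (ii) p. 114 «may be interpreted as isomorphisms of split Frobenioids … which
are compatible»; Remark 3.8.1 p. 115 [cite: Mochizuki2012, Cor 3.7 (i) p.111].  [FrdI] Thm. 6.2 (i) p. 111, Cor. 5.4 p. 103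
[cite: MochizukiFrdI2008, Cor. 5.4 p.103]; [FrdII] Ex. 1.3 (ii) p. 11 [cite: MochizukiFrdII2008, Ex 1.3 (ii) p.11].
Claim key DISPUTED (D-0012): nothing of [IUTchII] is asserted.

abc-iut cell, layer L6, MERGE-MAP row **R-Def38-a**, item «COR37i-FRD-SQUARES (b)» = row «PULL-COMP-ISO» part 2 (L6-lead
§F v1.19cq), seat abc-iut-L6-t7 gen 6.  PROOF-ONLY (0 `def`/`structure`/`instance`, no new `Prop` fact) over abc-iut-L6-t7's
`CoveringMonoid.frobenioidMapOver / dataHomOverOfEquivariant / invariantsHomOver / divisorNatTransOver / frobenioidMapOfPairIso`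
(p468022, FROZEN 67315581ad3d2ea3), `modelFrobenioid_hom_heq`, `associatesMap_comp`, `fgauMapOfPairIso` / `gaussianMonoidIso`
(p481435/p484077), abc-iut-L1's `MonGp.map_comp`, and the base-level law `CosetCat.pull_comp` (`pull aug₁ ⋙ pull aug₂ =
pull (aug₁ ∘ aug₂)` ON THE NOSE, `CosetCategoriesPullComp`) over abc-iut-L5-t2's `CosetCat.pull`.

WHAT IS PROVED.
* §1 `comp_equivariant_over` + **`frobenioidMapOver_comp`**: for `ψ₁ : Ψ → Ψ'` equivariant through `aug₁ : P₁ ↠ G` and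
  `ψ₂ : Ψ' → Ψ''` equivariant through `aug₂ : P₂ ↠ P₁`, `frobenioidMapOver ψ₁ ⋙ frobenioidMapOver ψ₂ = frobenioidMapOver (ψ₂ ∘ ψ₁)`
  over `pull (aug₁ ∘ aug₂) = pull aug₁ ⋙ pull aug₂` — EQUALITY of functors (`Functor.hext`: bases agree definitionally, classes by
  `MonGp.map_comp`, base maps by `Functor.hcongr_hom pull_comp`, `Div`/`u` componentwise);
* §2 **`frobenioidMapOfPairIso_comp : F(σ₁,ψ₁) ⋙ F(σ₂,ψ₂) = F(σ₁ ≫ σ₂, ψ₁ ≫ ψ₂)`** for isomorphisms of PAIRS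
  `(G ↷ Ψ) ⥲ (G' ↷ Ψ') ⥲ (G'' ↷ Ψ'')`, `frobenioidMapOfPairIso_congr`, and **`frobenioidMapOfPairIso_square`**: two factorizations
  `σ₂ ∘ σ₁ = σ₄ ∘ σ₃`, `ψ₂ ∘ ψ₁ = ψ₄ ∘ ψ₃` of the same isomorphism of pairs give the SAME composite functor — Cor 3.7 (i)'s
  «compatible [in the evident sense]» with the group identifications `G_v(Π_{v▶})_t ≅ G_v(M^Θ_*▶(†F_v))_t ≅ G_v(M^Θ_*(†F_v))_t` as
  INPUT isomorphisms `σᵢ`, no longer required to be performed beforehand (form (a), `GMonoidFrobenioidsComposition`);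
* §3 the Gaussian-typed instances `gaussianMonoidIso_trans` and **`fgauMapOfPairIso_comp`**
  (`F_ξ ⥤ F_{m₁∘ξ} ⥤ F_{m₂∘m₁∘ξ}` = `F_ξ ⥤ F_{(m₂m₁)∘ξ}`), `fgauMapOfPairIso_square`.
HONEST LIMITS: σᵢ, ψᵢ / mᵢ are INPUTS (what an isomorphism of mono-theta environments induces, Prop 3.4 (ii)); equalities
of functors are «evil» but are exactly Rmk 3.8.1's «isomorphism classes of equivalences» read strictly; no side taken on
[IUTchIII] Cor 3.12; typed ≠ proved; nothing asserts abc proved or refuted.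
-/

noncomputable section

namespace Literature.IUT.HodgeArakelov

open CategoryTheory Opposite Function
open Literature.AlgebraicGeometry.Frobenioids Literature.AnabelianGeometry.SemiGraphs

universe u v w

namespace CoveringMonoid

/-! ### §1. `frobenioidMapOver` composes over `pull aug₁ ⋙ pull aug₂ = pull (aug₁ ∘ aug₂)` -/

section Over

variable {G : Type u} [Group G] [TopologicalSpace G] {P₁ : Type u} [Group P₁] [TopologicalSpace P₁]
  {P₂ : Type u} [Group P₂] [TopologicalSpace P₂]
  {aug₁ : P₁ →* G} (hc₁ : Continuous aug₁) (hs₁ : Surjective aug₁)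
  {aug₂ : P₂ →* P₁} (hc₂ : Continuous aug₂) (hs₂ : Surjective aug₂)
  (hc₁₂ : Continuous (aug₁.comp aug₂)) (hs₁₂ : Surjective (aug₁.comp aug₂))
  {M : CoveringMonoid.{u, v} G} {M' : CoveringMonoid.{u, v} P₁} {M'' : CoveringMonoid.{u, v} P₂}
  (ψ₁ : M.O →* M'.O) (h₁ : ∀ (π : P₁) (x : M.O), ψ₁ (M.act (aug₁ π) x) = M'.act π (ψ₁ x))
  (ψ₂ : M'.O →* M''.O) (h₂ : ∀ (π : P₂) (x : M'.O), ψ₂ (M'.act (aug₂ π) x) = M''.act π (ψ₂ x))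

omit [TopologicalSpace G] [TopologicalSpace P₁] [TopologicalSpace P₂] in
include h₁ h₂ in
/-- The composite `ψ₂ ∘ ψ₁` is equivariant through `aug₁ ∘ aug₂`. [cite: Mochizuki2012, Def 3.8 (i) p.113] -/
theorem comp_equivariant_over :
    ∀ (π : P₂) (x : M.O), (ψ₂.comp ψ₁) (M.act ((aug₁.comp aug₂) π) x) = M''.act π ((ψ₂.comp ψ₁) x) :=
  fun π x => by rw [MonoidHom.comp_apply, MonoidHom.comp_apply, MonoidHom.comp_apply, h₁, h₂]

/-- Restriction to invariants composes across the two base changes. [cite: MochizukiFrdI2008, Thm. 6.2 (i) p.111] -/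
theorem invariantsHomOver_comp (X : CosetCat G) :
    invariantsHomOver (aug := aug₁.comp aug₂) hc₁₂ hs₁₂ (ψ₂.comp ψ₁) (comp_equivariant_over ψ₁ h₁ ψ₂ h₂) X =
      (invariantsHomOver hc₂ hs₂ ψ₂ h₂ ((CosetCat.pull aug₁ hc₁ hs₁).obj X)).comp (invariantsHomOver hc₁ hs₁ ψ₁ h₁ X) :=
  MonoidHom.ext fun _ => rfl

/-- `frobenioidMapOver` on objects: `(G/U, α) ↦ (P/aug⁻¹U, η^gp α)`. [cite: MochizukiFrdI2008, Thm. 6.2 (i) p.111] -/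
theorem frobenioidMapOver_obj (X : M.frobenioid) :
    (frobenioidMapOver hc₁ hs₁ ψ₁ h₁).obj X =
      ⟨(CosetCat.pull aug₁ hc₁ hs₁).obj X.base, gpApp (divisorNatTransOver hc₁ hs₁ ψ₁ h₁) (op X.base) X.cls⟩ := rfl

/-- `Div` under `frobenioidMapOver`. [cite: MochizukiFrdI2008, Thm. 6.2 (i) p.110] -/
theorem div_frobenioidMapOver_map {X Y : M.frobenioid} (f : X ⟶ Y) :
    ModelFrobenioid.div ((frobenioidMapOver hc₁ hs₁ ψ₁ h₁).map f) =
      associatesMap (invariantsHomOver hc₁ hs₁ ψ₁ h₁ X.base) (ModelFrobenioid.div f) := rfl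

/-- `u` under `frobenioidMapOver`. [cite: MochizukiFrdI2008, Thm. 6.2 (i) p.110] -/
theorem unit_frobenioidMapOver_map {X Y : M.frobenioid} (f : X ⟶ Y) :
    ModelFrobenioid.unit ((frobenioidMapOver hc₁ hs₁ ψ₁ h₁).map f) =
      MonGp.map (invariantsHomOver hc₁ hs₁ ψ₁ h₁ X.base) (ModelFrobenioid.unit f) := rfl

/-- The divisor-class components compose across the two base changes: `η₂^gp (η₁^gp α) = η₁₂^gp α`.
[cite: MochizukiFrdI2008, Thm. 6.2 (i) p.111] -/
theorem gpApp_divisorNatTransOver_comp (X : CosetCat G) (c : Algebra.GrothendieckGroup (M.divisorFunctor.obj (op X))) :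
    gpApp (divisorNatTransOver hc₂ hs₂ ψ₂ h₂) (op ((CosetCat.pull aug₁ hc₁ hs₁).obj X))
        (gpApp (divisorNatTransOver hc₁ hs₁ ψ₁ h₁) (op X) c) =
      gpApp (divisorNatTransOver (aug := aug₁.comp aug₂) hc₁₂ hs₁₂ (ψ₂.comp ψ₁)
        (comp_equivariant_over ψ₁ h₁ ψ₂ h₂)) (op X) c := by
  have key : (MonGp.map (associatesMap (invariantsHomOver hc₂ hs₂ ψ₂ h₂ ((CosetCat.pull aug₁ hc₁ hs₁).obj X)))).comp
      (MonGp.map (associatesMap (invariantsHomOver hc₁ hs₁ ψ₁ h₁ X))) =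
      MonGp.map (associatesMap (invariantsHomOver (aug := aug₁.comp aug₂) hc₁₂ hs₁₂ (ψ₂.comp ψ₁)
        (comp_equivariant_over ψ₁ h₁ ψ₂ h₂) X)) := by
    refine MonGp.hom_ext fun a => ?_
    obtain ⟨x, rfl⟩ := Associates.mk_surjective a
    rw [MonoidHom.comp_apply, MonGp.map_of, associatesMap_mk, MonGp.map_of, associatesMap_mk]
    refine ((MonGp.map_of _ _).trans ?_).symm
    refine (congrArg Algebra.GrothendieckGroup.of (associatesMap_mk _ _)).trans ?_
    rfl
  exact DFunLike.congr_fun key c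

/-- **`frobenioidMapOver ψ₁ ⋙ frobenioidMapOver ψ₂ = frobenioidMapOver (ψ₂ ∘ ψ₁)` over `pull aug₁ ⋙ pull aug₂ = pull (aug₁ ∘ aug₂)`**
([FrdI] Thm. 6.2 (i)'s «formal» functors compose; bases agree DEFINITIONALLY, base maps by `CosetCat.pull_comp`, classes by
`MonGp.map_comp`). [cite: MochizukiFrdI2008, Thm. 6.2 (i) p.111] -/
theorem frobenioidMapOver_comp :
    frobenioidMapOver hc₁ hs₁ ψ₁ h₁ ⋙ frobenioidMapOver hc₂ hs₂ ψ₂ h₂ =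
      frobenioidMapOver (aug := aug₁.comp aug₂) hc₁₂ hs₁₂ (ψ₂.comp ψ₁) (comp_equivariant_over ψ₁ h₁ ψ₂ h₂) := by
  have hobj : ∀ X : M.frobenioid, (frobenioidMapOver hc₁ hs₁ ψ₁ h₁ ⋙ frobenioidMapOver hc₂ hs₂ ψ₂ h₂).obj X =
      (frobenioidMapOver (aug := aug₁.comp aug₂) hc₁₂ hs₁₂ (ψ₂.comp ψ₁) (comp_equivariant_over ψ₁ h₁ ψ₂ h₂)).obj X := fun X => by
    change (frobenioidMapOver hc₂ hs₂ ψ₂ h₂).obj ((frobenioidMapOver hc₁ hs₁ ψ₁ h₁).obj X) = _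
    rw [frobenioidMapOver_obj, frobenioidMapOver_obj, frobenioidMapOver_obj, gpApp_divisorNatTransOver_comp]
    rfl
  refine Functor.hext hobj fun X Y f => ?_
  refine modelFrobenioid_hom_heq (hobj X) (hobj Y) _ _ rfl ?_ (heq_of_eq ?_) (heq_of_eq ?_)
  · -- base maps: `pull₂ (pull₁ f) ≍ pull₁₂ f`
    exact Functor.hcongr_hom (CosetCat.pull_comp aug₁ hc₁ hs₁ aug₂ hc₂ hs₂ hc₁₂ hs₁₂) (ModelFrobenioid.baseMap f)
  · -- `Div`: classes of classes
    have key : (associatesMap (invariantsHomOver hc₂ hs₂ ψ₂ h₂ ((CosetCat.pull aug₁ hc₁ hs₁).obj X.base))).comp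
        (associatesMap (invariantsHomOver hc₁ hs₁ ψ₁ h₁ X.base)) =
        associatesMap (invariantsHomOver (aug := aug₁.comp aug₂) hc₁₂ hs₁₂ (ψ₂.comp ψ₁)
          (comp_equivariant_over ψ₁ h₁ ψ₂ h₂) X.base) := by
      refine MonoidHom.ext fun a => ?_
      obtain ⟨x, rfl⟩ := Associates.mk_surjective a
      rw [MonoidHom.comp_apply, associatesMap_mk, associatesMap_mk]
      refine ((associatesMap_mk _ _).trans ?_).symm
      rfl
    exact DFunLike.congr_fun key (ModelFrobenioid.div f)
  · -- `u`: groupified restrictions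
    have key : (MonGp.map (invariantsHomOver hc₂ hs₂ ψ₂ h₂ ((CosetCat.pull aug₁ hc₁ hs₁).obj X.base))).comp
        (MonGp.map (invariantsHomOver hc₁ hs₁ ψ₁ h₁ X.base)) =
        MonGp.map (invariantsHomOver (aug := aug₁.comp aug₂) hc₁₂ hs₁₂ (ψ₂.comp ψ₁)
          (comp_equivariant_over ψ₁ h₁ ψ₂ h₂) X.base) := by
      refine MonGp.hom_ext fun x => ?_
      rw [MonoidHom.comp_apply, MonGp.map_of, MonGp.map_of]
      refine ((MonGp.map_of _ _).trans ?_).symm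
      rfl
    exact DFunLike.congr_fun key (ModelFrobenioid.unit f)

/-- `frobenioidMapOver` depends only on `(aug, ψ)` (the witnesses are proofs). [cite: MochizukiFrdI2008, Thm. 6.2 (i) p.111] -/
theorem frobenioidMapOver_congr {aug aug' : P₁ →* G} (haug : aug = aug') (hc : Continuous aug) (hc' : Continuous aug')
    (hs : Surjective aug) (hs' : Surjective aug') {ψ ψ' : M.O →* M'.O} (hψ : ψ = ψ')
    (h : ∀ (π : P₁) (x : M.O), ψ (M.act (aug π) x) = M'.act π (ψ x))
    (h' : ∀ (π : P₁) (x : M.O), ψ' (M.act (aug' π) x) = M'.act π (ψ' x)) :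
    frobenioidMapOver hc hs ψ h = frobenioidMapOver hc' hs' ψ' h' := by
  subst haug
  subst hψ
  rfl

end Over

/-! ### §2. Isomorphisms of PAIRS compose: `F(σ₁,ψ₁) ⋙ F(σ₂,ψ₂) = F(σ₁ ≫ σ₂, ψ₁ ≫ ψ₂)`; re-factorized squares -/

section PairIso

variable {G : Type u} [Group G] [TopologicalSpace G] {G' : Type u} [Group G'] [TopologicalSpace G']
  {G'' : Type u} [Group G''] [TopologicalSpace G'']
  {M : CoveringMonoid.{u, v} G} {M' : CoveringMonoid.{u, v} G'} {M'' : CoveringMonoid.{u, v} G''}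

/-- The composite of two isomorphisms of pairs is an isomorphism of pairs. [cite: Mochizuki2012, Cor 3.7 (i) p.111] -/
theorem trans_equivariant (σ₁ : G ≃ₜ* G') (ψ₁ : M.O ≃* M'.O)
    (h₁ : ∀ (g : G) (x : M.O), ψ₁ (M.act g x) = M'.act (σ₁ g) (ψ₁ x)) (σ₂ : G' ≃ₜ* G'') (ψ₂ : M'.O ≃* M''.O)
    (h₂ : ∀ (g : G') (x : M'.O), ψ₂ (M'.act g x) = M''.act (σ₂ g) (ψ₂ x)) :
    ∀ (g : G) (x : M.O), (ψ₁.trans ψ₂) (M.act g x) = M''.act ((σ₁.trans σ₂) g) ((ψ₁.trans ψ₂) x) :=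
  fun g x => by rw [MulEquiv.trans_apply, MulEquiv.trans_apply, h₁, h₂]; rfl

/-- **`F(σ₁,ψ₁) ⋙ F(σ₂,ψ₂) = F(σ₁ ≫ σ₂, ψ₁ ≫ ψ₂)`** — the functors of model Frobenioids induced by isomorphisms of PAIRS
`(G ↷ Ψ) ⥲ (G' ↷ Ψ') ⥲ (G'' ↷ Ψ'')` compose ON THE NOSE (over `pull σ₁⁻¹ ⋙ pull σ₂⁻¹ = pull (σ₂σ₁)⁻¹`).
[cite: Mochizuki2012, Cor 3.7 (i) p.111] -/
theorem frobenioidMapOfPairIso_comp (σ₁ : G ≃ₜ* G') (ψ₁ : M.O ≃* M'.O)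
    (h₁ : ∀ (g : G) (x : M.O), ψ₁ (M.act g x) = M'.act (σ₁ g) (ψ₁ x)) (σ₂ : G' ≃ₜ* G'') (ψ₂ : M'.O ≃* M''.O)
    (h₂ : ∀ (g : G') (x : M'.O), ψ₂ (M'.act g x) = M''.act (σ₂ g) (ψ₂ x)) :
    frobenioidMapOfPairIso σ₁ ψ₁ h₁ ⋙ frobenioidMapOfPairIso σ₂ ψ₂ h₂ =
      frobenioidMapOfPairIso (σ₁.trans σ₂) (ψ₁.trans ψ₂) (trans_equivariant σ₁ ψ₁ h₁ σ₂ ψ₂ h₂) := by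
  unfold frobenioidMapOfPairIso
  rw [frobenioidMapOver_comp σ₁.symm.continuous σ₁.symm.surjective σ₂.symm.continuous σ₂.symm.surjective
    (σ₁.trans σ₂).symm.continuous (σ₁.trans σ₂).symm.surjective]
  rfl

/-- `frobenioidMapOfPairIso` depends only on `(σ, ψ)`. [cite: Mochizuki2012, Cor 3.7 (i) p.111] -/
theorem frobenioidMapOfPairIso_congr {σ σ' : G ≃ₜ* G'} (hσ : σ = σ') {ψ ψ' : M.O ≃* M'.O} (hψ : ψ = ψ')
    (h : ∀ (g : G) (x : M.O), ψ (M.act g x) = M'.act (σ g) (ψ x))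
    (h' : ∀ (g : G) (x : M.O), ψ' (M.act g x) = M'.act (σ' g) (ψ' x)) :
    frobenioidMapOfPairIso σ ψ h = frobenioidMapOfPairIso σ' ψ' h' := by
  subst hσ
  subst hψ
  rfl

variable {G₁ : Type u} [Group G₁] [TopologicalSpace G₁] {M₁ : CoveringMonoid.{u, v} G₁}

/-- **Cor 3.7 (i) «compatible [in the evident sense] collections of isomorphisms», form (b): SQUARES over RE-FACTORIZED
group identifications commute ON THE NOSE** — if two chains of isomorphisms of pairs `(G ↷ Ψ) ⥲ (G' ↷ Ψ') ⥲ (G'' ↷ Ψ'')` and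
`(G ↷ Ψ) ⥲ (G₁ ↷ Ψ₁) ⥲ (G'' ↷ Ψ'')` have the same composite (`σ₁ ≫ σ₂ = σ₃ ≫ σ₄` on groups, `ψ₁ ≫ ψ₂ = ψ₃ ≫ ψ₄` on monoids —
e.g. `{G_v(Π_{v▶})_t} ⥲ {G_v(M^Θ_*▶(†F_v))_t} ⥲ {G_v(M^Θ_*(†F_v))_t}` and the monoid-level square `e₂ ∘ I = γ ∘ e₁` of w4-d019's
`cor37_i_square`), then the two composite functors of model Frobenioids are EQUAL. [cite: Mochizuki2012, Cor 3.7 (i) p.111] -/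
theorem frobenioidMapOfPairIso_square (σ₁ : G ≃ₜ* G') (ψ₁ : M.O ≃* M'.O)
    (h₁ : ∀ (g : G) (x : M.O), ψ₁ (M.act g x) = M'.act (σ₁ g) (ψ₁ x)) (σ₂ : G' ≃ₜ* G'') (ψ₂ : M'.O ≃* M''.O)
    (h₂ : ∀ (g : G') (x : M'.O), ψ₂ (M'.act g x) = M''.act (σ₂ g) (ψ₂ x)) (σ₃ : G ≃ₜ* G₁) (ψ₃ : M.O ≃* M₁.O)
    (h₃ : ∀ (g : G) (x : M.O), ψ₃ (M.act g x) = M₁.act (σ₃ g) (ψ₃ x)) (σ₄ : G₁ ≃ₜ* G'') (ψ₄ : M₁.O ≃* M''.O)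
    (h₄ : ∀ (g : G₁) (x : M₁.O), ψ₄ (M₁.act g x) = M''.act (σ₄ g) (ψ₄ x))
    (hσ : σ₁.trans σ₂ = σ₃.trans σ₄) (hψ : ψ₁.trans ψ₂ = ψ₃.trans ψ₄) :
    frobenioidMapOfPairIso σ₁ ψ₁ h₁ ⋙ frobenioidMapOfPairIso σ₂ ψ₂ h₂ =
      frobenioidMapOfPairIso σ₃ ψ₃ h₃ ⋙ frobenioidMapOfPairIso σ₄ ψ₄ h₄ := by
  rw [frobenioidMapOfPairIso_comp, frobenioidMapOfPairIso_comp]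
  exact frobenioidMapOfPairIso_congr hσ hψ _ _

/-- The pointwise form of the square's hypotheses (how the monoid-level `cor37_i_square` and the group-level identifications
are usually given). [cite: Mochizuki2012, Cor 3.7 (i) p.111] -/
theorem frobenioidMapOfPairIso_square' (σ₁ : G ≃ₜ* G') (ψ₁ : M.O ≃* M'.O)
    (h₁ : ∀ (g : G) (x : M.O), ψ₁ (M.act g x) = M'.act (σ₁ g) (ψ₁ x)) (σ₂ : G' ≃ₜ* G'') (ψ₂ : M'.O ≃* M''.O)
    (h₂ : ∀ (g : G') (x : M'.O), ψ₂ (M'.act g x) = M''.act (σ₂ g) (ψ₂ x)) (σ₃ : G ≃ₜ* G₁) (ψ₃ : M.O ≃* M₁.O)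
    (h₃ : ∀ (g : G) (x : M.O), ψ₃ (M.act g x) = M₁.act (σ₃ g) (ψ₃ x)) (σ₄ : G₁ ≃ₜ* G'') (ψ₄ : M₁.O ≃* M''.O)
    (h₄ : ∀ (g : G₁) (x : M₁.O), ψ₄ (M₁.act g x) = M''.act (σ₄ g) (ψ₄ x))
    (hσ : ∀ g : G, σ₂ (σ₁ g) = σ₄ (σ₃ g)) (hψ : ∀ x : M.O, ψ₂ (ψ₁ x) = ψ₄ (ψ₃ x)) :
    frobenioidMapOfPairIso σ₁ ψ₁ h₁ ⋙ frobenioidMapOfPairIso σ₂ ψ₂ h₂ =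
      frobenioidMapOfPairIso σ₃ ψ₃ h₃ ⋙ frobenioidMapOfPairIso σ₄ ψ₄ h₄ :=
  frobenioidMapOfPairIso_square σ₁ ψ₁ h₁ σ₂ ψ₂ h₂ σ₃ ψ₃ h₃ σ₄ ψ₄ h₄ (ContinuousMulEquiv.ext fun g => hσ g)
    (MulEquiv.ext fun x => hψ x)

end PairIso

end CoveringMonoid

/-! ### §3. The Gaussian-typed instances -/

namespace BadPrimeGaussianMonoids

open CoveringMonoid

variable {T : Type w} {M : Type v} [CommMonoid M] {M' : Type v} [CommMonoid M'] {M'' : Type v} [CommMonoid M'']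
  {G : Type u} [Group G] [TopologicalSpace G] {G' : Type u} [Group G'] [TopologicalSpace G']
  {G'' : Type u} [Group G''] [TopologicalSpace G'']
  (β : G →* MulAut M) (β' : G' →* MulAut M') (β'' : G'' →* MulAut M'')

omit [TopologicalSpace G] [TopologicalSpace G'] [TopologicalSpace G''] in
/-- The middle isomorphisms compose: `(Ψ_ξ ⥲ Ψ_{m₁∘ξ}) ≫ (Ψ_{m₁∘ξ} ⥲ Ψ_{m₂∘m₁∘ξ}) = (Ψ_ξ ⥲ Ψ_{(m₂m₁)∘ξ})` (both are `piIso` of the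
composite). [cite: Mochizuki2012, Cor 3.7 (i) p.111] -/
theorem gaussianMonoidIso_trans (m₁ : M ≃* M') (m₂ : M' ≃* M'') (ξ : T → M) :
    (gaussianMonoidIso m₁ ξ).trans (gaussianMonoidIso m₂ (fun t => m₁ (ξ t))) = gaussianMonoidIso (m₁.trans m₂) ξ :=
  MulEquiv.ext fun _ => Subtype.ext rfl

/-- **`F_ξ ⥤ F_{m₁∘ξ} ⥤ F_{m₂∘m₁∘ξ}` IS `F_ξ ⥤ F_{(m₂m₁)∘ξ}`**: the Frobenioid-level middle isomorphisms of Cor 3.7 (i) compose on the nose.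
[cite: Mochizuki2012, Cor 3.7 (i) p.111] -/
theorem fgauMapOfPairIso_comp (σ₁ : G ≃ₜ* G') (m₁ : M ≃* M') (hm₁ : ∀ (g : G) (y : M), m₁ (β g y) = β' (σ₁ g) (m₁ y))
    (σ₂ : G' ≃ₜ* G'') (m₂ : M' ≃* M'') (hm₂ : ∀ (g : G') (y : M'), m₂ (β' g y) = β'' (σ₂ g) (m₂ y)) (ξ : T → M)
    (hS : ∀ (g : G) (y : T → M), y ∈ gaussianMonoid ξ → piIso T (β g) y ∈ gaussianMonoid ξ)
    (hS' : ∀ (g' : G') (y' : T → M'), y' ∈ gaussianMonoid (fun t => m₁ (ξ t)) →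
      piIso T (β' g') y' ∈ gaussianMonoid (fun t => m₁ (ξ t)))
    (hS'' : ∀ (g'' : G'') (y'' : T → M''), y'' ∈ gaussianMonoid (fun t => m₂ (m₁ (ξ t))) →
      piIso T (β'' g'') y'' ∈ gaussianMonoid (fun t => m₂ (m₁ (ξ t))))
    (hm : ∀ (g : G) (y : M), (m₁.trans m₂) (β g y) = β'' ((σ₁.trans σ₂) g) ((m₁.trans m₂) y)) :
    fgauMapOfPairIso β β' σ₁ m₁ hm₁ ξ hS hS' ⋙ fgauMapOfPairIso β' β'' σ₂ m₂ hm₂ (fun t => m₁ (ξ t)) hS' hS'' =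
      fgauMapOfPairIso β β'' (σ₁.trans σ₂) (m₁.trans m₂) hm ξ hS hS'' := by
  unfold fgauMapOfPairIso
  rw [frobenioidMapOfPairIso_comp]
  exact frobenioidMapOfPairIso_congr rfl (gaussianMonoidIso_trans m₁ m₂ ξ) _ _

end BadPrimeGaussianMonoids

end Literature.IUT.HodgeArakelov

end
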